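import Literature.MathematicalPhysics.QuantumManyBody.PeriodicFeynmanKacDuhamel
import HarnessLib

/-!
# Stub `stub_mildDuhamelFK` (R1) of line `third-law-current-floor` for crux `HardCoreExtension`
# (stmt-AtomisticToContinuum-11786): the mild Duhamel identity of the periodic Feynman–Kac functional

The registered stub, verbatim: for a measurable pair potential `v` with BOUNDED periodisation
`v^per ≤ C`, a measurable observable `g ≥ 0`, `T ≥ 0` and every `X`,
`E[g(B_T)] = (e^{-TH}g)(X) + ∫_{s∈(0,T]} E[ W(B_s) · (e^{-(T-s)H} g)(B_s) ] ds`
(`W = ∑_{i<j} v^per(xᵢ-xⱼ)`, `e^{-tH} = periodicFKSemigroup v L t`, `B_s = X + √2 b_s`). It is the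
Literature fact `periodicFKSemigroup_duhamel` (`PeriodicFeynmanKacDuhamel.lean`: pathwise
a.e.-fundamental theorem of calculus for `s ↦ exp(-∫ₛᵀ W(B_r) dr)` + the weak Markov property of the
world-lines at time `s`), restated in the shape the skeleton consumes (with `∃ C` in place of a
named bound). Downstream: `stub_forwardDuhamelOfMild` turns it into the forward Duhamel identity
of the Feynman–Kac ground state, whence `C¹`-regularity (S6r) by Gaussian smoothing
(`stub_duhamelSmoothing`).
-/

noncomputable section

namespace Summit.AtomisticToContinuum.BoseEinsteinCondensation.Cruxes.HardCoreExtension.ThirdLawCurrentFloor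

open MeasureTheory
open scoped ENNReal NNReal
open Literature.MathematicalPhysics.QuantumManyBody.BoseGas

/-- **R1 `stub_mildDuhamelFK`** (registered stub of line `third-law-current-floor`, crux
stmt-AtomisticToContinuum-11786): the mild Duhamel identity of the periodic Feynman–Kac functional
against the free flow, for a measurable pair potential with bounded periodisation, a measurable
`[0,∞]`-valued observable, `T ≥ 0` and every starting configuration — the Literature fact
`periodicFKSemigroup_duhamel`. [cite: ChungZhao1995, §3.2 (26) and Thm 3.10] -/
theorem stub_mildDuhamelFK :
    ∀ (N : ℕ) (L : ℝ) (v : ℝ → ℝ≥0∞), Measurable v →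
      (∃ C : ℝ≥0, ∀ x, periodizedPotential v L x ≤ C) →
      ∀ g : Config N → ℝ≥0∞, Measurable g → ∀ T : ℝ, 0 ≤ T → ∀ X : Config N,
        ∫⁻ ω, g (worldLine X ω T.toNNReal) ∂wienerPaths N =
          periodicFKSemigroup v L T g X +
            ∫⁻ s in Set.Ioc (0 : ℝ) T, ∫⁻ ω,
              periodicInteraction v L (worldLine X ω s.toNNReal) *
                periodicFKSemigroup v L (T - s) g (worldLine X ω s.toNNReal) ∂wienerPaths N := by
  intro N L v hv hC g hg T hT X
  obtain ⟨C, hC⟩ := hC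
  exact periodicFKSemigroup_duhamel hv hC hg hT X

end Summit.AtomisticToContinuum.BoseEinsteinCondensation.Cruxes.HardCoreExtension.ThirdLawCurrentFloor

end
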